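import Literature.NumberTheory.GaloisRepresentations.HerbrandTheorem
import Literature.NumberTheory.GaloisRepresentations.TameInertiaCyclicProofs
import Literature.NumberTheory.GaloisRepresentations.TameInertiaProofs
import Mathlib.RingTheory.DiscreteValuationRing.Basic
import Mathlib.NumberTheory.RamificationInertia.Galois
import Mathlib.RingTheory.LocalRing.Etale
import Mathlib.Algebra.Polynomial.Identities
import HarnessLib

/-!
# Herbrand's theorem for layers of `F̄` over a local field: the index formula (trunk GalRep, item C9)

D-0014 keeps `Literature/` sorry-free by stating cited results as named facts `def X : Prop`.
`HerbrandTheorem.lean` reduces the named fact `Literature.herbrand_quotient R E` (Serre, *Local Fields*,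
Ch. IV §3, Prop. 14: the upper numbering passes to quotients) to the single arithmetic input
`Literature.NumberTheory.GaloisRepresentations.IndexFormula` (Serre, Ch. IV §1, Prop. 3), announcing its discharge in a file of the present name.
This file proves the index formula, and hence Herbrand's theorem, **for the finite Galois layers of
`F̄` over a non-archimedean local field `F`**:

* `Literature.herbrand_quotient_of_isNonarchimedeanLocalField F L E : herbrand_quotient 𝒪[F] E` for
  `L/F` finite Galois inside `F̄` and `E` a normal subextension of `L/F` — exactly the hypothesis
  `hq` of `SerreWeightExistence.exists_isSerreWeight_of_herbrand_quotient`,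
  `absUpperInertia_map_absRestrictNormalHom_of_herbrand_quotient` and of the `_of_herbrand_quotient`
  theorems of `ArtinConductorProofs` / `ArtinConductorIntegralityProofs` (with `R = 𝒪[F]`).

The proof follows Serre, *Local Fields* (GTM 67), literally:

* Ch. III §6, Prop. 12 with Lemmas 3–4 (**monogenicity**, `exists_adjoin_eq_top_of_isDiscreteValuationRing`):
  if `S` is a discrete valuation ring, finite over the local ring `R`, with separable residue
  extension, then `S = R[x]`.  Lemma 4 (`exists_residue_eq_and_irreducible_aeval`): a primitive
  element of the residue extension lifts to `x` with `Q(x)` a uniformiser for some `Q ∈ R[X]`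
  (Taylor expansion, Mathlib `Polynomial.binomExpansion`); then every element is `q(x)` modulo
  `𝔪_S^m` by induction on `m` (Lemma 3), `𝔪_R S = 𝔪_S^e`, and Nakayama
  (Mathlib `Submodule.le_of_le_smul_of_le_jacobson_bot`, as in Mathlib's étale case
  `IsLocalRing.exists_adjoin_eq_top`).
* Ch. IV §1, Lemma 1 and the definition of `i_G` (`lowerIndex_eq_addVal`): for a generator `x`,
  `s ∈ G_i ⇔ v(s x - x) ≥ i + 1`, i.e. `i_G(s) = v(s x - x)`.
* Ch. IV §1, Prop. 3, "proof after J. Tate" (`indexFormula_of_adjoin_eq_top`, abstract DVR form):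
  with `a = s(y) - y` and `b = ∏_{t ∈ H} (s t(x) - x)`, `a ∣ b` because `s(f) - f` has coefficients
  divisible by `a` for the `H`-invariant polynomial `f = ∏_{t ∈ H} (X - t(x))` whose coefficients lie
  in `S' = R[y]`, and `b ∣ a` because `f` divides `g - y` for `y = g(x)`; hence `v(a) = v(b)`,
  i.e. `e' · i_{G/H}(σ) = Σ_{s → σ} i_G(s)` with `e' = v(ι π')`, and `e' = Card(H_0)`
  (`natCard_ramificationSubgroup_ker_zero_eq_addVal`, Mathlib `Ideal.card_inertia_eq_ramificationIdxIn`: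
  Serre Ch. I §7, Cor. to Prop. 22 / Ch. IV §1, Cor. to Prop. 2).
* The local case (`indexFormula_intermediateField`): `O_L = integralClosure 𝒪[F] L` is a DVR
  (`isDiscreteValuationRing_integralClosure`, tree), so is `O_E` (transport along `E ≃ lift E ⊆ F̄`),
  the residue fields are finite (separability is automatic), `O_L^{Gal(L/E)} = O_E` (Galois theory),
  and `Gal(L/F)` acts faithfully (tree).

## References

* J.-P. Serre, *Local Fields*, GTM 67, Springer 1979: Ch. III §6, Prop. 12, Lemmas 3–4 (pp. 57–58);
  Ch. IV §1, Lemma 1, Prop. 1–3 and Remark 2 (pp. 61–64); Ch. IV §3, Prop. 14. [SerreLocalFields1979]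
* J. Neukirch, *Algebraic Number Theory*, Springer 1999, Ch. II §10. [NeukirchANT1999]
-/

noncomputable section

open Polynomial IsLocalRing
open scoped Pointwise

namespace Literature.NumberTheory.GaloisRepresentations

section Lemma1

variable {R S : Type*} [CommRing R] [CommRing S] [Algebra R S]
variable {G : Type*} [Group G] [MulSemiringAction G S] [SMulCommClass G R S]

/-- If `x` generates `S` as an `R`-algebra and `σ` acts by `R`-algebra automorphisms, then
`σ x - x` divides `σ b - b` for every `b ∈ S` (`b = q(x)`, and `u - w ∣ q(u) - q(w)`).  This is the
mechanism of Serre's Lemma 1 ("the image `x_i` of `x` in `A_L/𝔭_L^{i+1}` generates it as an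
`A_K`-algebra").  Ref: Serre, *Local Fields*, Ch. IV §1, Lemma 1, p. 61. [folklore] -/
theorem smul_sub_dvd_smul_sub_of_adjoin_eq_top {x : S} (hx : Algebra.adjoin R {x} = ⊤) (σ : G) (b : S) :
    σ • x - x ∣ σ • b - b := by
  have hb : b ∈ Algebra.adjoin R {x} := hx ▸ Algebra.mem_top
  rw [Algebra.adjoin_singleton_eq_range_aeval, AlgHom.mem_range] at hb
  obtain ⟨q, hq⟩ := hb
  have h1 : σ • aeval x q = aeval (σ • x) q := by
    change MulSemiringAction.toAlgHom R S σ (aeval x q) = _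
    rw [← Polynomial.aeval_algHom_apply]
    rfl
  rw [← hq, h1, ← Polynomial.eval_map_algebraMap, ← Polynomial.eval_map_algebraMap]
  exact Polynomial.sub_dvd_eval_sub _ _ _

/-- For an ideal `I`: `σ` acts trivially modulo `I` iff `σ x ≡ x (mod I)` for a generator `x`
(Serre's Lemma 1, a) ⇔ c)).  Ref: Serre, *Local Fields*, Ch. IV §1, Lemma 1, p. 61.
[cite: SerreLocalFields1979, Ch. IV §1 Lemma 1 (p. 61)] -/
theorem forall_smul_sub_mem_iff_of_adjoin_eq_top {x : S} (hx : Algebra.adjoin R {x} = ⊤) (σ : G)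
    (I : Ideal S) : (∀ b, σ • b - b ∈ I) ↔ σ • x - x ∈ I :=
  ⟨fun h => h x, fun h b => by
    obtain ⟨c, hc⟩ := smul_sub_dvd_smul_sub_of_adjoin_eq_top hx σ b
    rw [hc]; exact I.mul_mem_right _ h⟩

variable [IsDomain S] [IsDiscreteValuationRing S]

/-- A ring automorphism of a local ring stabilises the maximal ideal (so for a local `S` every `σ`
lies in the decomposition group `G_{-1} = G`).  Ref: Serre, *Local Fields*, Ch. IV §1, Prop. 1. [folklore] -/
theorem smul_maximalIdeal (σ : G) : σ • maximalIdeal S = maximalIdeal S := by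
  have h : (σ • maximalIdeal S).IsMaximal := by
    -- image of a maximal ideal under a ring automorphism
    have := Ideal.map_isMaximal_of_equiv (MulSemiringAction.toRingEquiv G S σ) (p := maximalIdeal S)
    exact this
  exact IsLocalRing.eq_maximalIdeal h

/-- **Serre's Lemma 1**: for a generator `x` of the DVR `S` over `R`, `s ∈ G_i ↔ s x - x ∈ 𝔪_S^{i+1}`
(i.e. `v(s x - x) ≥ i + 1`).  Ref: Serre, *Local Fields*, Ch. IV §1, Lemma 1 and Prop. 1, p. 61.
[cite: SerreLocalFields1979, Ch. IV §1 Lemma 1 (p. 61)] -/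
theorem mem_ramificationSubgroup_iff_of_adjoin_eq_top {x : S} (hx : Algebra.adjoin R {x} = ⊤)
    (σ : G) (i : ℕ) :
    σ ∈ (maximalIdeal S).ramificationSubgroup G i ↔ σ • x - x ∈ maximalIdeal S ^ (i + 1) := by
  rw [Ideal.mem_ramificationSubgroup_iff, forall_smul_sub_mem_iff_of_adjoin_eq_top hx]
  exact ⟨fun h => h.2, fun h => ⟨smul_maximalIdeal σ, h⟩⟩

/-- Membership in a power of the maximal ideal of a DVR via `addVal`: `y ∈ 𝔪^n ↔ n ≤ v(y)`. [folklore] -/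
theorem mem_maximalIdeal_pow_iff_le_addVal (y : S) (n : ℕ) :
    y ∈ maximalIdeal S ^ n ↔ (n : ℕ∞) ≤ IsDiscreteValuationRing.addVal S y := by
  obtain ⟨π, hπ⟩ := IsDiscreteValuationRing.exists_irreducible S
  rw [hπ.maximalIdeal_eq, Ideal.span_singleton_pow, Ideal.mem_span_singleton, ← IsDiscreteValuationRing.addVal_le_iff_dvd,
    IsDiscreteValuationRing.addVal_pow, IsDiscreteValuationRing.addVal_uniformizer hπ, nsmul_one]

/-- **`i_G(s) = v_L(s(x) - x)`** for an `R`-generator `x` of the DVR `S` (Serre's definition of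
`i_G`, here a theorem about the tree's `lowerIndex`, which is defined from the filtration `G_i`):
both sides are characterised by `i + 1 ≤ · ⇔ s ∈ G_i`.
Ref: Serre, *Local Fields*, Ch. IV §1, p. 62 ("`i_G(s) = v_L(s(x) - x)` … `i_G(s) ≥ i + 1 ⇔ s ∈ G_i`").
[cite: SerreLocalFields1979, Ch. IV §1 (p. 62, definition of i_G)] -/
theorem lowerIndex_eq_addVal {x : S} (hx : Algebra.adjoin R {x} = ⊤) (σ : G) :
    lowerIndex (maximalIdeal S) G σ = IsDiscreteValuationRing.addVal S (σ • x - x) := by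
  refine le_antisymm (ENat.le_of_forall_natCast_add_one_le fun i hi => ?_)
    (ENat.le_of_forall_natCast_add_one_le fun i hi => ?_)
  · rw [add_one_le_lowerIndex_iff, mem_ramificationSubgroup_iff_of_adjoin_eq_top hx,
      mem_maximalIdeal_pow_iff_le_addVal] at hi
    exact_mod_cast hi
  · rw [add_one_le_lowerIndex_iff, mem_ramificationSubgroup_iff_of_adjoin_eq_top hx,
      mem_maximalIdeal_pow_iff_le_addVal]
    exact_mod_cast hi

end Lemma1

section Prop3

variable {R S S' : Type*} [CommRing R] [CommRing S] [CommRing S'] [Algebra R S] [Algebra R S']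
  [IsDomain S] [IsDiscreteValuationRing S] [IsDomain S'] [IsDiscreteValuationRing S']
variable {G Q : Type*} [Group G] [Group Q] [MulSemiringAction G S] [SMulCommClass G R S]
  [MulSemiringAction Q S'] [SMulCommClass Q R S']

/-- `addVal` of a finite product is the sum of the `addVal`s. [folklore] -/
theorem addVal_prod {ι : Type*} (s : Finset ι) (f : ι → S) :
    IsDiscreteValuationRing.addVal S (∏ i ∈ s, f i) = ∑ i ∈ s, IsDiscreteValuationRing.addVal S (f i) := by
  classical
  induction s using Finset.induction_on with
  | empty => simp
  | insert a s ha ih => rw [Finset.prod_insert ha, Finset.sum_insert ha, IsDiscreteValuationRing.addVal_mul, ih]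

/-- Along a homomorphism `ι : S' → S` of DVRs mapping a uniformiser `π'` of `S'` into the maximal
ideal of `S`, valuations scale by the ramification index `e' = v(ι π')`: `v(ι z) = v'(z) · e'`
(Serre: "`e' · i_{G/H}(σ) = v_L(σ(y) - y)`").  Ref: Serre, *Local Fields*, Ch. IV §1, proof of
Prop. 3, p. 62; Ch. I §7 (`v_L = e v_K` on `K`). [folklore] -/
theorem addVal_map_eq_mul (ι : S' →+* S) {π' : S'} (hπ' : Irreducible π')
    (hloc : ι π' ∈ maximalIdeal S) (z : S') :
    IsDiscreteValuationRing.addVal S (ι z) =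
      IsDiscreteValuationRing.addVal S' z * IsDiscreteValuationRing.addVal S (ι π') := by
  have he : IsDiscreteValuationRing.addVal S (ι π') ≠ 0 := by
    rw [Ne, IsDiscreteValuationRing.addVal_eq_zero_iff]
    exact (IsLocalRing.mem_maximalIdeal _).mp hloc
  by_cases hz : z = 0
  · subst hz
    rw [map_zero, IsDiscreteValuationRing.addVal_zero, IsDiscreteValuationRing.addVal_zero, ENat.top_mul he]
  obtain ⟨n, u, rfl⟩ := IsDiscreteValuationRing.eq_unit_mul_pow_irreducible hz hπ'
  have hu : IsDiscreteValuationRing.addVal S (ι ↑u) = 0 :=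
    IsDiscreteValuationRing.addVal_eq_zero_of_unit (Units.map (ι : S' →* S) u)
  rw [map_mul, map_pow, IsDiscreteValuationRing.addVal_mul, IsDiscreteValuationRing.addVal_pow,
    IsDiscreteValuationRing.addVal_def' u hπ' n, hu, zero_add]
  clear hz hu
  induction n with
  | zero => simp
  | succ n ih => rw [succ_nsmul, ih, Nat.cast_succ, add_mul, one_mul]

omit [IsDomain S] [IsDiscreteValuationRing S] [SMulCommClass G R S] in
/-- If the coefficients of `P ∈ S[X]` are fixed by `t`, then `P(t z) = t P(z)`. [folklore] -/
theorem eval_smul_of_map_eq (t : G) {P : S[X]} (hP : P.map (MulSemiringAction.toRingHom G S t) = P) (z : S) :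
    P.eval (t • z) = t • P.eval z := by
  conv_lhs => rw [← hP]
  rw [Polynomial.eval_map, ← MulSemiringAction.toRingHom_apply G S t z, Polynomial.eval₂_hom,
    MulSemiringAction.toRingHom_apply]


/-- **The index formula (Serre, *Local Fields*, Ch. IV §1, Prop. 3, "proof after J. Tate"), abstract
DVR form.**  Setting: `R → S' →ι S` with `S`, `S'` discrete valuation rings, a finite group `G`
acting faithfully on `S` by `R`-automorphisms, `Q` acting on `S'`, `π : G →* Q` with `ι` equivariant
(`ι(π g · z) = g · ι z`), the `ker π`-invariants of `S` inside `ι(S')` (`S^H = A_{K'}`), generators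
`S = R[x]`, `S' = R[y]` (Prop. 12), a uniformiser `π'` of `S'` with `ι π' ∈ 𝔪_S`, and
`Card(H_0) = v(ι π')` (`= e_{L/K'}`).  Conclusion: the tree's `IndexFormula (𝔪_S) (𝔪_{S'}) π`, i.e.
`Card(H_0) · i_{G/H}(π s) = Σ_{t ∈ H} i_G(s t)` for `s ∈ G_0 ∖ H`.
Proof (Serre, p. 62): `e' i_{G/H}(σ) = v(a)`, `a = s(ιy) - ιy` (`lowerIndex_eq_addVal` for `y` and
`addVal_map_eq_mul`), and `Σ_t i_G(st) = v(b)`, `b = ∏_{t ∈ H} (x - s t x)` (`lowerIndex_eq_addVal`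
for `x`); `a ∣ b`: `f = ∏_{t ∈ H} (X - t x)` is `H`-invariant, so its coefficients are `ι(c_i)` with
`σ c_i - c_i` divisible by `σ y - y`, whence `a` divides `s(f)(x) - f(x) = b - 0`; `b ∣ a`: `ιy = g(x)`,
`g - ιy` is `H`-invariant and vanishes at the `Card(H)` distinct points `t x` (faithfulness), so
`f ∣ g - ιy` (Mathlib `Multiset.prod_X_sub_C_dvd_iff_le_roots`), and applying `s` and evaluating at
`x` gives `ιy - s(ιy) = b · s(h)(x)`.
Ref: Serre, *Local Fields*, Ch. IV §1, Prop. 3, pp. 62–63.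
[cite: SerreLocalFields1979, Ch. IV §1 Prop. 3 (pp. 62–63, proof after Tate)] -/
theorem indexFormula_of_adjoin_eq_top [Finite G] [FaithfulSMul G S]
    (π : G →* Q) (ι : S' →ₐ[R] S)
    (hequiv : ∀ (g : G) (z : S'), ι (π g • z) = g • ι z)
    (hinv : ∀ b : S, (∀ t ∈ π.ker, t • b = b) → ∃ z, ι z = b)
    {x : S} (hx : Algebra.adjoin R {x} = ⊤) {y : S'} (hy : Algebra.adjoin R {y} = ⊤)
    {π' : S'} (hπ' : Irreducible π') (hloc : ι π' ∈ maximalIdeal S)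
    (hcard : (Nat.card ((maximalIdeal S).ramificationSubgroup π.ker 0) : ℕ∞) =
      IsDiscreteValuationRing.addVal S (ι π')) :
    IndexFormula (maximalIdeal S) (maximalIdeal S') π := by
  classical
  intro s _ hsH
  haveI := Fintype.ofFinite ↥π.ker
  -- notation: `φ g` is the action of `g` as a ring endomorphism, `a = s(ιy) - ιy`,
  -- `f = ∏_{t ∈ H} (X - t x)`, `fs = s(f)`, `b = fs(x) = ∏_{t ∈ H} (x - s t x)`
  have hφ : ∀ (g : G) (z : S), MulSemiringAction.toRingHom G S g z = g • z := fun g z => rfl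
  have hφR : ∀ g : G, (MulSemiringAction.toRingHom G S g).comp (algebraMap R S) = algebraMap R S :=
    fun g => RingHom.ext fun r => by rw [RingHom.comp_apply, hφ, smul_algebraMap]
  obtain ⟨a, ha⟩ : ∃ a : S, a = s • ι y - ι y := ⟨_, rfl⟩
  have ha' : a = ι (π s • y - y) := by rw [ha, map_sub, hequiv]
  obtain ⟨f, hf⟩ : ∃ f : S[X], f = ∏ t : π.ker, (X - C (((t : π.ker) : G) • x)) := ⟨_, rfl⟩
  obtain ⟨b, hb⟩ : ∃ b : S, b = ∏ t : π.ker, (x - s • (((t : π.ker) : G) • x)) := ⟨_, rfl⟩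
  have hmapf : ∀ g : G, f.map (MulSemiringAction.toRingHom G S g) =
      ∏ t : π.ker, (X - C (g • (((t : π.ker) : G) • x))) := fun g => by
    rw [hf, Polynomial.map_prod]
    refine Finset.prod_congr rfl fun t _ => ?_
    rw [Polynomial.map_sub, Polynomial.map_X, Polynomial.map_C, hφ]
  have hfx : f.eval x = 0 := by
    rw [hf, Polynomial.eval_prod]
    exact Finset.prod_eq_zero (Finset.mem_univ (1 : π.ker)) (by simp)
  have hfsx : (f.map (MulSemiringAction.toRingHom G S s)).eval x = b := by
    rw [hmapf, Polynomial.eval_prod, hb]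
    refine Finset.prod_congr rfl fun t _ => ?_
    rw [Polynomial.eval_sub, Polynomial.eval_X, Polynomial.eval_C]
  -- (1) the right-hand side is `v(b)`
  have hrhs : ∑ᶠ t : π.ker, lowerIndex (maximalIdeal S) G (s * t) =
      IsDiscreteValuationRing.addVal S b := by
    rw [finsum_eq_sum_of_fintype, hb, addVal_prod]
    refine Finset.sum_congr rfl fun t _ => ?_
    rw [lowerIndex_eq_addVal hx, ← AddValuation.map_neg, neg_sub, mul_smul]
  -- (2) the left-hand side is `v(a)`
  have hlhs : (Nat.card ((maximalIdeal S).ramificationSubgroup π.ker 0) : ℕ∞) *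
      lowerIndex (maximalIdeal S') Q (π s) = IsDiscreteValuationRing.addVal S a := by
    rw [hcard, lowerIndex_eq_addVal hy, ha', mul_comm]
    exact (addVal_map_eq_mul (ι : S' →+* S) hπ' hloc _).symm
  -- (3) `a ∣ b`: the coefficients of `f` are `H`-invariant, hence come from `S' = R[y]`
  have hab : a ∣ b := by
    have hcoef : ∀ i, a ∣ s • f.coeff i - f.coeff i := by
      intro i
      have hfix : ∀ t ∈ π.ker, t • f.coeff i = f.coeff i := by
        intro t ht
        have hmap : f.map (MulSemiringAction.toRingHom G S t) = f := by
          rw [hmapf, hf]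
          exact Fintype.prod_equiv (Equiv.mulLeft ⟨t, ht⟩) _ _ fun t' => by
            simp only [Equiv.coe_mulLeft, Subgroup.coe_mul, mul_smul]
        have := congrArg (fun p => p.coeff i) hmap
        simpa only [Polynomial.coeff_map, hφ] using this
      obtain ⟨c, hc⟩ := hinv _ hfix
      obtain ⟨w, hw⟩ := smul_sub_dvd_smul_sub_of_adjoin_eq_top hy (π s) c
      refine ⟨ι w, ?_⟩
      rw [← hc, ← hequiv, ← map_sub, hw, map_mul, ha']
    have hC : C a ∣ f.map (MulSemiringAction.toRingHom G S s) - f := by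
      rw [Polynomial.C_dvd_iff_dvd_coeff]
      intro i
      rw [Polynomial.coeff_sub, Polynomial.coeff_map, hφ]
      exact hcoef i
    obtain ⟨q, hq⟩ := hC
    have := congrArg (Polynomial.eval x) hq
    rw [Polynomial.eval_sub, hfsx, hfx, sub_zero, Polynomial.eval_mul, Polynomial.eval_C] at this
    exact ⟨_, this⟩
  -- (4) `b ∣ a`: `ιy = g(x)`; `g - ιy` vanishes at the `t x`, `t ∈ H`, so `f ∣ g - ιy`
  have hba : b ∣ a := by
    have hyx : ι y ∈ Algebra.adjoin R {x} := hx ▸ Algebra.mem_top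
    rw [Algebra.adjoin_singleton_eq_range_aeval, AlgHom.mem_range] at hyx
    obtain ⟨g, hg⟩ := hyx
    obtain ⟨P, hP⟩ : ∃ P : S[X], P = g.map (algebraMap R S) - C (ι y) := ⟨_, rfl⟩
    have hmapP : ∀ g' : G, P.map (MulSemiringAction.toRingHom G S g') =
        g.map (algebraMap R S) - C (g' • ι y) := fun g' => by
      rw [hP, Polynomial.map_sub, Polynomial.map_map, hφR, Polynomial.map_C, hφ]
    by_cases hP0 : P = 0
    · -- then `ι y ∈ R` is fixed by `s`, so `a = 0`
      have h0' : g.map (algebraMap R S) = C (ι y) := sub_eq_zero.mp (hP ▸ hP0)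
      have h0 := congrArg (fun p : S[X] => p.coeff 0) h0'
      simp only [Polynomial.coeff_C_zero, Polynomial.coeff_map] at h0
      rw [ha, ← h0, smul_algebraMap, sub_self]
      exact dvd_zero b
    have hPx : P.eval x = 0 := by
      rw [hP, Polynomial.eval_sub, Polynomial.eval_map_algebraMap, hg, Polynomial.eval_C, sub_self]
    -- the `t x`, `t ∈ H`, are distinct roots of `P`
    have hroot : ∀ t : π.ker, P.IsRoot (((t : π.ker) : G) • x) := fun t => by
      have hfixP : P.map (MulSemiringAction.toRingHom G S (t : G)) = P := by
        rw [hmapP, ← hequiv, (MonoidHom.mem_ker).mp t.2, one_smul, hP]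
      rw [Polynomial.IsRoot, eval_smul_of_map_eq (t : G) hfixP, hPx, smul_zero]
    have hinj : Function.Injective fun t : π.ker => ((t : π.ker) : G) • x := by
      intro t₁ t₂ h12
      have h1 : (((t₂ : π.ker) : G)⁻¹ * (t₁ : G)) • x - x ∈ (⊥ : Ideal S) := by
        rw [Ideal.mem_bot, mul_smul, show ((t₁ : π.ker) : G) • x = (t₂ : G) • x from h12, inv_smul_smul,
          sub_self]
      have h2 := (forall_smul_sub_mem_iff_of_adjoin_eq_top hx _ ⊥).mpr h1
      have h3 : ((t₂ : π.ker) : G)⁻¹ * (t₁ : G) = 1 :=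
        FaithfulSMul.eq_of_smul_eq_smul (α := S) fun z => by
          rw [one_smul]; exact sub_eq_zero.mp (Ideal.mem_bot.mp (h2 z))
      exact Subtype.ext (inv_mul_eq_one.mp h3).symm
    set M : Multiset S := (Finset.univ : Finset π.ker).val.map fun t => ((t : π.ker) : G) • x with hM
    have hMnodup : M.Nodup :=
      (Multiset.nodup_map_iff_inj_on Finset.univ.nodup).mpr fun t₁ _ t₂ _ h => hinj h
    have hMle : M ≤ P.roots := by
      rw [Multiset.le_iff_subset hMnodup]
      intro r hr
      rw [hM, Multiset.mem_map] at hr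
      obtain ⟨t, -, rfl⟩ := hr
      exact (Polynomial.mem_roots hP0).mpr (hroot t)
    have hfdvd : f ∣ P := by
      have := (Multiset.prod_X_sub_C_dvd_iff_le_roots hP0 M).mpr hMle
      rwa [hM, Multiset.map_map, Function.comp_def, Finset.prod_map_val, ← hf] at this
    obtain ⟨h, hh⟩ := hfdvd
    have := congrArg (fun p => (p.map (MulSemiringAction.toRingHom G S s)).eval x) hh
    simp only [hmapP, Polynomial.map_mul, Polynomial.eval_mul, hfsx, Polynomial.eval_sub,
      Polynomial.eval_map_algebraMap, hg, Polynomial.eval_C] at this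
    -- `this : ι y - s • ι y = b * _`
    rw [ha, ← neg_sub, this]
    exact (dvd_mul_right b _).neg_right
  -- conclusion: `v(a) = v(b)`
  rw [hlhs, hrhs]
  exact le_antisymm (IsDiscreteValuationRing.addVal_le_iff_dvd.mpr hab)
    (IsDiscreteValuationRing.addVal_le_iff_dvd.mpr hba)


/-- The ramification index `e(𝔪_S/𝔪_{S'})` (Mathlib's `Ideal.ramificationIdx'`) of an extension of
DVRs is `v_S(π')` for a uniformiser `π'` of `S'`: `𝔪_{S'} S = π' S = 𝔪_S^{v(π')}`.
Ref: Serre, *Local Fields*, Ch. I §7 (definition of `e`). [folklore] -/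
theorem ramificationIdx'_maximalIdeal_eq_addVal [Algebra S' S] {π' : S'} (hπ' : Irreducible π')
    (h0 : algebraMap S' S π' ≠ 0) :
    ((Ideal.ramificationIdx' (maximalIdeal S') (maximalIdeal S) : ℕ) : ℕ∞) =
      IsDiscreteValuationRing.addVal S (algebraMap S' S π') := by
  obtain ⟨ϖ, hϖ⟩ := IsDiscreteValuationRing.exists_irreducible S
  obtain ⟨a, u, hu⟩ := IsDiscreteValuationRing.eq_unit_mul_pow_irreducible h0 hϖ
  have hQ0 : maximalIdeal S ≠ ⊥ := by
    rw [hϖ.maximalIdeal_eq, Ne, Ideal.span_singleton_eq_bot]; exact hϖ.ne_zero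
  have hmap : (maximalIdeal S').map (algebraMap S' S) = maximalIdeal S ^ a := by
    rw [hπ'.maximalIdeal_eq, Ideal.map_span, Set.image_singleton, hϖ.maximalIdeal_eq,
      Ideal.span_singleton_pow, hu]
    exact Ideal.span_singleton_mul_left_unit u.isUnit _
  have hea : Ideal.ramificationIdx' (maximalIdeal S') (maximalIdeal S) = a := by
    refine Ideal.ramificationIdx'_spec (le_of_eq hmap) ?_
    rw [hmap]
    exact not_le_of_gt (Ideal.pow_succ_lt_pow hQ0 a)
  rw [hea, hu, IsDiscreteValuationRing.addVal_def' u hϖ a]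

omit [SMulCommClass G R S] [SMulCommClass Q R S'] in
/-- **`Card(H_0) = e_{L/K'}`** in the abstract setting of `indexFormula_of_adjoin_eq_top`: the
inertia group of `𝔪_S` in `H = ker π` has order `v_S(ι π')`.  `H` is a Galois group for `S/S'` in
Mathlib's sense (`IsGaloisGroup`: faithful, `S'`-linear, invariants `= S'`), so Mathlib's
`Ideal.card_inertia_eq_ramificationIdxIn` (finite, hence perfect, residue field) gives
`Card(I(𝔪_S)) = e`, and `e = v_S(ι π')` (`ramificationIdx'_maximalIdeal_eq_addVal`).
Ref: Serre, *Local Fields*, Ch. I §7, Cor. to Prop. 22 ("`T` is of order `e`") and Ch. IV §1,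
Cor. to Prop. 2. [cite: SerreLocalFields1979, Ch. IV §1 Cor. to Prop. 2 (p. 61)] -/
theorem natCard_ramificationSubgroup_ker_zero_eq_addVal [Finite G] [FaithfulSMul G S]
    [Module.Finite R S] [Finite (ResidueField S')]
    (π : G →* Q) (ι : S' →ₐ[R] S) (hι : Function.Injective ι)
    (hequiv : ∀ (g : G) (z : S'), ι (π g • z) = g • ι z)
    (hinv : ∀ b : S, (∀ t ∈ π.ker, t • b = b) → ∃ z, ι z = b)
    {π' : S'} (hπ' : Irreducible π') :
    (Nat.card ((maximalIdeal S).ramificationSubgroup π.ker 0) : ℕ∞) =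
      IsDiscreteValuationRing.addVal S (ι π') := by
  classical
  letI : Algebra S' S := (ι : S' →+* S).toAlgebra
  have halg : ∀ z : S', algebraMap S' S z = ι z := fun z => rfl
  haveI : IsScalarTower R S' S := IsScalarTower.of_algebraMap_eq fun r => (ι.commutes r).symm
  haveI : Module.Finite S' S := Module.Finite.of_restrictScalars_finite R S' S
  haveI : FaithfulSMul S' S := (faithfulSMul_iff_algebraMap_injective S' S).mpr hι
  haveI : Module.IsTorsionFree S' S := (Module.isTorsionFree_iff_faithfulSMul).mpr inferInstance
  haveI : Module.Flat S' S := inferInstance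
  haveI : FaithfulSMul (↥π.ker) S := ⟨fun {t₁ t₂} h =>
    Subtype.ext (FaithfulSMul.eq_of_smul_eq_smul (M := G) (α := S) fun b => h b)⟩
  haveI : SMulCommClass (↥π.ker) S' S := ⟨fun t z b => by
    have ht : (t : G) • ι z = ι z := by rw [← hequiv, (MonoidHom.mem_ker).mp t.2, one_smul]
    rw [Algebra.smul_def, Algebra.smul_def, smul_mul', halg]
    change ((t : G) • ι z) * _ = _
    rw [ht]⟩
  haveI : IsGaloisGroup (↥π.ker) S' S :=
    ⟨inferInstance, inferInstance, ⟨fun b hb => hinv b fun t ht => hb ⟨t, ht⟩⟩⟩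
  -- `𝔪_S` lies over `𝔪_{S'}`
  have hcomap : (maximalIdeal S).comap (algebraMap S' S) = maximalIdeal S' := by
    haveI : (maximalIdeal S).IsMaximal := IsLocalRing.maximalIdeal.isMaximal S
    have hint : (algebraMap S' S).IsIntegral := fun b => Algebra.IsIntegral.isIntegral b
    haveI := Ideal.isMaximal_comap_of_isIntegral_of_isMaximal' (algebraMap S' S) hint (maximalIdeal S)
    exact IsLocalRing.eq_maximalIdeal inferInstance
  haveI : (maximalIdeal S).LiesOver (maximalIdeal S') := ⟨hcomap.symm⟩
  haveI : Finite (S' ⧸ maximalIdeal S') := ‹Finite (ResidueField S')›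
  haveI : Finite (maximalIdeal S').ResidueField :=
    Finite.of_surjective _ (Ideal.bijective_algebraMap_quotient_residueField (maximalIdeal S')).2
  haveI : PerfectField (maximalIdeal S').ResidueField := PerfectField.ofFinite
  have h := Ideal.card_inertia_eq_ramificationIdxIn (G := ↥π.ker) (maximalIdeal S') (maximalIdeal S)
  have hm0 : maximalIdeal S' ≠ ⊥ := by
    rw [hπ'.maximalIdeal_eq, Ne, Ideal.span_singleton_eq_bot]; exact hπ'.ne_zero
  have hπ0 : algebraMap S' S π' ≠ 0 := (map_ne_zero_iff _ hι).mpr hπ'.ne_zero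
  rw [Ideal.ramificationSubgroup_zero, h, Ideal.ramificationIdxIn_eq_ramificationIdx (maximalIdeal S')
    (maximalIdeal S) (↥π.ker), ← Ideal.ramificationIdx'_eq_ramificationIdx _ _ hm0]
  exact ramificationIdx'_maximalIdeal_eq_addVal hπ' hπ0

end Prop3


section Monogenic
open Polynomial Algebra

section DVR

variable {S : Type*} [CommRing S] [IsDomain S] [IsDiscreteValuationRing S]

/-- In a DVR, an element of `𝔪 ∖ 𝔪²` is a uniformiser (irreducible). [folklore] -/
theorem irreducible_of_mem_maximalIdeal_of_not_mem_sq {y : S} (h1 : y ∈ maximalIdeal S)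
    (h2 : y ∉ maximalIdeal S ^ 2) : Irreducible y := by
  obtain ⟨π, hπ⟩ := IsDiscreteValuationRing.exists_irreducible S
  have hy0 : y ≠ 0 := fun h => h2 (h ▸ zero_mem _)
  obtain ⟨a, u, rfl⟩ := IsDiscreteValuationRing.eq_unit_mul_pow_irreducible hy0 hπ
  have hm : maximalIdeal S = Ideal.span {π} := hπ.maximalIdeal_eq
  rcases Nat.lt_or_ge a 1 with ha | ha
  · obtain rfl : a = 0 := by omega
    exfalso
    rw [pow_zero, mul_one] at h1
    exact (IsLocalRing.mem_maximalIdeal _).mp h1 u.isUnit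
  rcases Nat.lt_or_ge a 2 with ha2 | ha2
  · obtain rfl : a = 1 := by omega
    rw [pow_one]
    exact (irreducible_units_mul u).mpr hπ
  · exfalso
    apply h2
    rw [hm, Ideal.span_singleton_pow]
    exact Ideal.mul_mem_left _ _ (Ideal.mem_span_singleton'.mpr
      ⟨π ^ (a - 2), by rw [← pow_add, Nat.sub_add_cancel ha2]⟩)

/-- A uniformiser of a DVR does not lie in `𝔪²`. [folklore] -/
theorem not_mem_maximalIdeal_sq_of_irreducible {π : S} (hπ : Irreducible π) : π ∉ maximalIdeal S ^ 2 := by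
  rw [hπ.maximalIdeal_eq, Ideal.span_singleton_pow, Ideal.mem_span_singleton']
  rintro ⟨d, hd⟩
  apply hπ.not_isUnit
  have h1 : d * π * π = 1 * π := by rw [one_mul, mul_assoc, ← pow_two, hd]
  exact isUnit_iff_exists_inv.mpr ⟨d, by rw [mul_comm]; exact mul_right_cancel₀ hπ.ne_zero h1⟩

end DVR

variable {R S : Type*} [CommRing R] [CommRing S] [Algebra R S]
    [IsLocalRing R] [IsDomain S] [IsDiscreteValuationRing S] [Module.Finite R S] [FaithfulSMul R S]

/-- **Serre's Lemma 4** (Ch. III §6): any element `β₀` of the residue field of the DVR `S` (finite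
over the local ring `R`, separable residue extension) lifts to `x ∈ S` together with `Q ∈ R[X]` such
that `Q(x)` is a uniformiser of `S`: take `Q` lifting the (separable) minimal polynomial of `β₀` and a
lift `x₁`; then `Q(x₁) ∈ 𝔪_S` and `Q'(x₁)` is a unit; if `Q(x₁) ∈ 𝔪_S²`, replace `x₁` by `x₁ + π₀`:
`Q(x₁ + π₀) = Q(x₁) + π₀ Q'(x₁) + π₀² c ∈ 𝔪_S ∖ 𝔪_S²` (Taylor, Mathlib `Polynomial.binomExpansion`).
Ref: Serre, *Local Fields*, Ch. III §6, Lemma 4, pp. 57–58.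
[cite: SerreLocalFields1979, Ch. III §6 Lemma 4 (pp. 57–58)] -/
theorem exists_residue_eq_and_irreducible_aeval [Algebra.IsSeparable (ResidueField R) (ResidueField S)]
    (β₀ : ResidueField S) :
    ∃ x : S, residue S x = β₀ ∧ ∃ Q : R[X], Irreducible (aeval x Q) := by
  obtain ⟨x₁, hx₁⟩ := residue_surjective (R := S) β₀
  obtain ⟨π₀, hπ₀⟩ := IsDiscreteValuationRing.exists_irreducible S
  -- lift the (separable) minimal polynomial of `β₀`
  set μ := minpoly (ResidueField R) β₀ with hμ
  have hsep : μ.Separable := Algebra.IsSeparable.isSeparable (ResidueField R) β₀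
  obtain ⟨Q, hQ⟩ := Polynomial.map_surjective _ (residue_surjective (R := R)) μ
  have hQx : residue S (aeval x₁ Q) = 0 := by
    rw [map_aeval_eq_aeval_map (ψ := residue S) (φ := residue R) rfl, hQ, hx₁, hμ, minpoly.aeval]
  have hQ'x : IsUnit (aeval x₁ (derivative Q)) := by
    apply (residue_ne_zero_iff_isUnit _).mp
    rw [map_aeval_eq_aeval_map (ψ := residue S) (φ := residue R) rfl, ← derivative_map, hQ, hx₁]
    exact hsep.aeval_derivative_ne_zero (hμ ▸ minpoly.aeval _ _)
  have hmem : aeval x₁ Q ∈ maximalIdeal S := (residue_eq_zero_iff _).mp hQx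
  have hπ₀mem : π₀ ∈ maximalIdeal S := hπ₀.maximalIdeal_eq ▸ Ideal.mem_span_singleton_self π₀
  by_cases h2 : aeval x₁ Q ∈ maximalIdeal S ^ 2
  · -- replace `x₁` by `x₁ + π₀` (Taylor expansion to second order)
    refine ⟨x₁ + π₀, by rw [map_add, (residue_eq_zero_iff π₀).mpr hπ₀mem, add_zero, hx₁], Q, ?_⟩
    obtain ⟨c, hc⟩ := Polynomial.binomExpansion (Q.map (algebraMap R S)) x₁ π₀
    rw [Polynomial.eval_map_algebraMap, Polynomial.eval_map_algebraMap, derivative_map,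
      Polynomial.eval_map_algebraMap] at hc
    rw [hc]
    refine irreducible_of_mem_maximalIdeal_of_not_mem_sq ?_ ?_
    · exact add_mem (add_mem hmem (Ideal.mul_mem_left _ _ hπ₀mem)) (Ideal.mul_mem_left _ _
        ((pow_two π₀).symm ▸ Ideal.mul_mem_left _ _ hπ₀mem))
    · intro h
      have hsq : c * π₀ ^ 2 ∈ maximalIdeal S ^ 2 := Ideal.mul_mem_left _ _ (Ideal.pow_mem_pow hπ₀mem 2)
      have h3 : aeval x₁ (derivative Q) * π₀ ∈ maximalIdeal S ^ 2 := by
        have e : aeval x₁ (derivative Q) * π₀ =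
            (aeval x₁ Q + aeval x₁ (derivative Q) * π₀ + c * π₀ ^ 2) - aeval x₁ Q - c * π₀ ^ 2 := by ring
        rw [e]
        exact sub_mem (sub_mem h h2) hsq
      obtain ⟨v, hv⟩ := hQ'x
      apply not_mem_maximalIdeal_sq_of_irreducible hπ₀
      have : π₀ = ↑v⁻¹ * (aeval x₁ (derivative Q) * π₀) := by rw [← hv, ← mul_assoc, Units.inv_mul, one_mul]
      rw [this]
      exact Ideal.mul_mem_left _ _ h3
  · exact ⟨x₁, hx₁, Q, irreducible_of_mem_maximalIdeal_of_not_mem_sq hmem h2⟩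


variable {R S : Type*} [CommRing R] [CommRing S] [Algebra R S]
    [IsLocalRing R] [IsDomain S] [IsDiscreteValuationRing S] [Module.Finite R S] [FaithfulSMul R S]

/-- **Monogenicity (Serre, *Local Fields*, Ch. III §6, Prop. 12).**  Let `S` be a discrete valuation
ring which is a finite faithful algebra over the local ring `R`, with separable residue extension and
`𝔪_R S ≠ 0`.  Then `S = R[x]` for some `x ∈ S`.  (Serre: "B has a basis over A composed of the powers
of a single element x"; here the generation statement `Algebra.adjoin R {x} = ⊤`, which is what Ch. IV
uses: "let x be an `A_K`-generator of `A_L`".)  Proof: with `x`, `Q` from Lemma 4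
(`exists_residue_eq_and_irreducible_aeval`) and the uniformiser `π = Q(x) ∈ R[x]`, every `s ∈ S` is
`q(x)` modulo `𝔪_S^m` for all `m` (induction, Serre's Lemma 3: the residue field is generated by the
class of `x`), `𝔪_R S = 𝔪_S^e`, so `S = R[x] + 𝔪_R S` and Nakayama concludes.
Ref: Serre, *Local Fields*, Ch. III §6, Prop. 12 with Lemmas 3–4, pp. 57–58.
[cite: SerreLocalFields1979, Ch. III §6 Prop. 12 (pp. 57–58)] -/
theorem exists_adjoin_eq_top_of_isDiscreteValuationRing
    [Algebra.IsSeparable (ResidueField R) (ResidueField S)]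
    (hmap : (maximalIdeal R).map (algebraMap R S) ≠ ⊥) :
    ∃ x : S, Algebra.adjoin R {x} = ⊤ := by
  classical
  obtain ⟨β₀, hβ₀⟩ := Field.exists_primitive_element (ResidueField R) (ResidueField S)
  obtain ⟨x, hx, Q, hQ⟩ := exists_residue_eq_and_irreducible_aeval (R := R) β₀
  refine ⟨x, ?_⟩
  have hgen : Algebra.adjoin (ResidueField R) {β₀} = ⊤ := by
    rw [← IntermediateField.adjoin_simple_toSubalgebra_of_isAlgebraic (IsAlgebraic.of_finite _ _),
      hβ₀, IntermediateField.top_toSubalgebra]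
  -- every `s` is `q(x)` modulo `𝔪_S`
  have hres : ∀ s : S, ∃ q : R[X], s - aeval x q ∈ maximalIdeal S := by
    intro s
    rw [adjoin_singleton_eq_range_aeval, AlgHom.range_eq_top] at hgen
    obtain ⟨p, hp⟩ := hgen (residue S s)
    obtain ⟨q, rfl⟩ := Polynomial.map_surjective _ residue_surjective p
    refine ⟨q, ?_⟩
    rw [← residue_eq_zero_iff, map_sub, sub_eq_zero,
      map_aeval_eq_aeval_map (ψ := residue S) (φ := residue R) rfl, hx]
    exact hp.symm
  -- Serre's Lemma 3, in the form: every `s` is `q(x)` modulo `𝔪_S ^ m` (`π = Q(x) ∈ R[x]`)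
  have hind : ∀ (m : ℕ) (s : S), ∃ q : R[X], s - aeval x q ∈ maximalIdeal S ^ m := by
    intro m
    induction m with
    | zero => intro s; exact ⟨0, by rw [pow_zero, Ideal.one_eq_top]; exact Submodule.mem_top⟩
    | succ m ih =>
      intro s
      obtain ⟨q, hq⟩ := ih s
      rw [hQ.maximalIdeal_eq, Ideal.span_singleton_pow, Ideal.mem_span_singleton'] at hq
      obtain ⟨c, hc⟩ := hq
      obtain ⟨q', hq'⟩ := hres c
      rw [hQ.maximalIdeal_eq, Ideal.mem_span_singleton'] at hq'
      obtain ⟨d, hd⟩ := hq'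
      refine ⟨q + Q ^ m * q', ?_⟩
      rw [hQ.maximalIdeal_eq, Ideal.span_singleton_pow, Ideal.mem_span_singleton']
      refine ⟨d, ?_⟩
      rw [map_add, map_mul, map_pow]
      linear_combination hc + (aeval x Q) ^ m * hd
  -- `𝔪_R S = 𝔪_S ^ e`, and Nakayama
  obtain ⟨e, he⟩ := IsDiscreteValuationRing.ideal_eq_span_pow_irreducible hmap hQ
  refine eq_top_iff.mpr <| Submodule.le_of_le_smul_of_le_jacobson_bot
      (Module.finite_def.mp inferInstance) (IsLocalRing.maximalIdeal_le_jacobson ⊥)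
      (?_ : ⊤ ≤ (adjoin R {x}).toSubmodule ⊔ maximalIdeal R • ⊤)
  intro s _
  obtain ⟨q, hq⟩ := hind e s
  rw [Ideal.smul_top_eq_map]
  refine Submodule.mem_sup.mpr ⟨aeval x q, ?_, s - aeval x q, ?_, by abel⟩
  · rw [Subalgebra.mem_toSubmodule, adjoin_singleton_eq_range_aeval]; exact ⟨q, rfl⟩
  · rw [Submodule.restrictScalars_mem, he, ← Ideal.span_singleton_pow, ← hQ.maximalIdeal_eq]
    exact hq


end Monogenic

/-! ### The local case: layers of `F̄` over a non-archimedean local field -/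

section LocalField

open Field ValuativeRel
open scoped Valued

variable (F : Type*) [Field F] [ValuativeRel F] [TopologicalSpace F] [IsNonarchimedeanLocalField F]

omit [TopologicalSpace F] [IsNonarchimedeanLocalField F] in
/-- `𝒪[F] → integralClosure 𝒪[F] K'` is injective for any field extension `K'/F` (it is the
inclusion `𝒪[F] ⊂ F ⊂ K'` corestricted). [folklore] -/
theorem faithfulSMul_valuationInteger_integralClosure (K' : Type*) [Field K'] [Algebra F K']
    [Algebra 𝒪[F] K'] [IsScalarTower 𝒪[F] F K'] : FaithfulSMul 𝒪[F] (integralClosure 𝒪[F] K') := by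
  refine (faithfulSMul_iff_algebraMap_injective _ _).mpr fun a b hab => ?_
  have := congrArg (fun y : integralClosure 𝒪[F] K' => (y : K')) hab
  simp only [Subalgebra.coe_algebraMap] at this
  rw [IsScalarTower.algebraMap_apply 𝒪[F] F K', IsScalarTower.algebraMap_apply 𝒪[F] F K'] at this
  exact IsFractionRing.injective 𝒪[F] F ((algebraMap F K').injective this)

variable (L : IntermediateField F (AlgebraicClosure F))

/-- For a finite `L/F` inside `F̄` and an intermediate field `E` of `L/F` which is Galois over `F`,
`O_E = integralClosure 𝒪[F] E` is a discrete valuation ring: transport of the tree's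
`isDiscreteValuationRing_integralClosure` (Serre, Ch. II §2, Prop. 3) along `E ≃ lift E ⊆ F̄`
(Mathlib `IntermediateField.liftAlgEquiv`, `AlgEquiv.mapIntegralClosure`,
`IsDiscreteValuationRing.RingEquivClass.isDiscreteValuationRing`).
Ref: Serre, *Local Fields*, Ch. II §2, Prop. 3. [cite: SerreLocalFields1979, Ch. II §2 Prop. 3] -/
theorem isDiscreteValuationRing_integralClosure_intermediateField [FiniteDimensional F L]
    (E : IntermediateField F L) [IsGalois F E] : IsDiscreteValuationRing (integralClosure 𝒪[F] E) := by
  set e := IntermediateField.liftAlgEquiv E with he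
  haveI : FiniteDimensional F (IntermediateField.lift E) := LinearEquiv.finiteDimensional e.toLinearEquiv
  haveI : IsGalois F (IntermediateField.lift E) := IsGalois.of_algEquiv e
  haveI := isDiscreteValuationRing_integralClosure F (IntermediateField.lift E)
  exact IsDiscreteValuationRing.RingEquivClass.isDiscreteValuationRing
    ((e.restrictScalars 𝒪[F]).mapIntegralClosure).symm

variable [FiniteDimensional F L] [IsGalois F L] (E : IntermediateField F L) [Normal F E]

omit [IsGalois F L] [Normal F E] in
/-- The prime `𝔓 ∩ O_E` below a maximal ideal `𝔓` of the DVR `O_L` is the maximal ideal of the DVR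
`O_E` (contraction of a maximal ideal along an integral extension). [folklore] -/
theorem comap_integralClosureInclusion_eq_maximalIdeal (𝔓 : Ideal (integralClosure 𝒪[F] L)) [𝔓.IsMaximal]
    [IsGalois F E] :
    haveI := isDiscreteValuationRing_integralClosure_intermediateField F L E
    𝔓.comap (E.integralClosureInclusion 𝒪[F]) = maximalIdeal (integralClosure 𝒪[F] E) := by
  haveI := isDiscreteValuationRing_integralClosure_intermediateField F L E
  haveI : (𝔓.comap (E.integralClosureInclusion 𝒪[F])).IsMaximal := by
    refine Ideal.isMaximal_comap_of_isIntegral_of_isMaximal' (E.integralClosureInclusion 𝒪[F]).toRingHom ?_ 𝔓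
    refine RingHom.IsIntegral.tower_top (algebraMap 𝒪[F] (integralClosure 𝒪[F] E)) _ ?_
    rw [AlgHom.toRingHom_eq_coe, AlgHom.comp_algebraMap]
    exact algebraMap_isIntegral_iff.mpr inferInstance
  exact IsLocalRing.eq_maximalIdeal this

omit [TopologicalSpace F] [IsNonarchimedeanLocalField F] in
/-- **`O_L^{Gal(L/E)} = O_E`**: an element of `O_L` fixed by `ker (Gal(L/F) → Gal(E/F)) = Gal(L/E)`
lies in `E` (Galois correspondence, Mathlib `IsGalois.fixedField_fixingSubgroup`) and is integral, so
comes from `O_E`.  (Serre: `A_{K'} = A_L ∩ K'`.)  Ref: Serre, *Local Fields*, Ch. IV §1, proof of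
Prop. 3 (`f ∈ A_{K'}[X]`). [folklore] -/
theorem exists_integralClosureInclusion_eq_of_forall_smul (b : integralClosure 𝒪[F] L)
    (hb : ∀ t ∈ (AlgEquiv.restrictNormalHom E : (L ≃ₐ[F] L) →* (E ≃ₐ[F] E)).ker, t • b = b) :
    ∃ z, E.integralClosureInclusion 𝒪[F] z = b := by
  have hbE : (b : L) ∈ E := by
    rw [← IsGalois.fixedField_fixingSubgroup E, IntermediateField.mem_fixedField_iff]
    intro f hf
    have hf' : f ∈ (AlgEquiv.restrictNormalHom E : (L ≃ₐ[F] L) →* (E ≃ₐ[F] E)).ker := by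
      rw [IntermediateField.restrictNormalHom_ker]; exact hf
    have := congrArg Subtype.val (hb f hf')
    rwa [integralClosure.coe_smul] at this
  have hbint : IsIntegral 𝒪[F] (⟨(b : L), hbE⟩ : E) := by
    rw [← isIntegral_algHom_iff (E.val.restrictScalars 𝒪[F]) (E.val : E →+* L).injective]
    exact b.2
  exact ⟨⟨⟨(b : L), hbE⟩, hbint⟩, Subtype.ext rfl⟩

/-- **The index formula for layers of `F̄` over a local field** (Serre, Ch. IV §1, Prop. 3): for
`L/F` finite Galois inside `F̄`, `E` a normal subextension of `L/F` and `𝔓` the maximal ideal of the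
DVR `O_L`, the tree's `IndexFormula 𝔓 (𝔓 ∩ O_E) (Gal(L/F) → Gal(E/F))` holds: apply
`indexFormula_of_adjoin_eq_top` with generators from `exists_adjoin_eq_top_of_isDiscreteValuationRing`
(finite residue fields), `Card(H_0) = e` from `natCard_ramificationSubgroup_ker_zero_eq_addVal`,
invariants from `exists_integralClosureInclusion_eq_of_forall_smul`, and the faithfulness of `Gal(L/F)`
on `O_L` (`faithfulSMul_algEquiv_integralClosure_intermediateField`).
Ref: Serre, *Local Fields*, Ch. IV §1, Prop. 3, pp. 62–63 (with Remark 2, p. 64, on the global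
dictionary `s ∈ G_i(𝔓) ⇔ s(x) ≡ x mod 𝔓^{i+1}`).
[cite: SerreLocalFields1979, Ch. IV §1 Prop. 3 (pp. 62–63)] -/
theorem indexFormula_intermediateField (𝔓 : Ideal (integralClosure 𝒪[F] L)) [𝔓.IsMaximal] :
    IndexFormula 𝔓 (𝔓.comap (E.integralClosureInclusion 𝒪[F]))
      (AlgEquiv.restrictNormalHom E : (L ≃ₐ[F] L) →* (E ≃ₐ[F] E)) := by
  classical
  haveI : IsGalois F E := ⟨⟩
  haveI hS : IsDiscreteValuationRing (integralClosure 𝒪[F] L) := isDiscreteValuationRing_integralClosure F L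
  haveI hS' : IsDiscreteValuationRing (integralClosure 𝒪[F] E) :=
    isDiscreteValuationRing_integralClosure_intermediateField F L E
  have hP : 𝔓 = maximalIdeal (integralClosure 𝒪[F] L) := IsLocalRing.eq_maximalIdeal inferInstance
  have hQ := comap_integralClosureInclusion_eq_maximalIdeal F L E 𝔓
  rw [hQ]
  subst hP
  -- hypotheses of the abstract index formula
  haveI : FaithfulSMul (L ≃ₐ[F] L) (integralClosure 𝒪[F] L) :=
    faithfulSMul_algEquiv_integralClosure_intermediateField F L
  haveI : Module.Finite 𝒪[F] (integralClosure 𝒪[F] L) := IsIntegralClosure.finite 𝒪[F] F L _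
  haveI : Module.Finite 𝒪[F] (integralClosure 𝒪[F] E) := IsIntegralClosure.finite 𝒪[F] F E _
  haveI : FaithfulSMul 𝒪[F] (integralClosure 𝒪[F] L) := faithfulSMul_valuationInteger_integralClosure F L
  haveI : FaithfulSMul 𝒪[F] (integralClosure 𝒪[F] E) := faithfulSMul_valuationInteger_integralClosure F E
  have hι : Function.Injective (E.integralClosureInclusion 𝒪[F]) := E.integralClosureInclusion_injective 𝒪[F]
  have hequiv : ∀ (g : L ≃ₐ[F] L) (z : integralClosure 𝒪[F] E),
      E.integralClosureInclusion 𝒪[F] (AlgEquiv.restrictNormalHom E g • z) =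
        g • E.integralClosureInclusion 𝒪[F] z :=
    fun g z => E.integralClosureInclusion_restrictNormalHom_smul 𝒪[F] g z
  have hinv := exists_integralClosureInclusion_eq_of_forall_smul F L E
  -- generators (Serre III §6 Prop. 12)
  obtain ⟨ϖ, hϖ⟩ := IsDiscreteValuationRing.exists_irreducible 𝒪[F]
  have hmapL : (maximalIdeal 𝒪[F]).map (algebraMap 𝒪[F] (integralClosure 𝒪[F] L)) ≠ ⊥ := by
    rw [hϖ.maximalIdeal_eq, Ideal.map_span, Set.image_singleton, Ne, Ideal.span_singleton_eq_bot]
    exact (map_ne_zero_iff _ (FaithfulSMul.algebraMap_injective _ _)).mpr hϖ.ne_zero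
  have hmapE : (maximalIdeal 𝒪[F]).map (algebraMap 𝒪[F] (integralClosure 𝒪[F] E)) ≠ ⊥ := by
    rw [hϖ.maximalIdeal_eq, Ideal.map_span, Set.image_singleton, Ne, Ideal.span_singleton_eq_bot]
    exact (map_ne_zero_iff _ (FaithfulSMul.algebraMap_injective _ _)).mpr hϖ.ne_zero
  obtain ⟨x, hx⟩ := exists_adjoin_eq_top_of_isDiscreteValuationRing (R := 𝒪[F])
    (S := integralClosure 𝒪[F] L) hmapL
  obtain ⟨y, hy⟩ := exists_adjoin_eq_top_of_isDiscreteValuationRing (R := 𝒪[F])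
    (S := integralClosure 𝒪[F] E) hmapE
  -- a uniformiser of `O_E` maps into the maximal ideal of `O_L`
  obtain ⟨π', hπ'⟩ := IsDiscreteValuationRing.exists_irreducible (integralClosure 𝒪[F] E)
  have hloc : E.integralClosureInclusion 𝒪[F] π' ∈ maximalIdeal (integralClosure 𝒪[F] L) := by
    have : π' ∈ (maximalIdeal (integralClosure 𝒪[F] L)).comap (E.integralClosureInclusion 𝒪[F]) := by
      rw [hQ, hπ'.maximalIdeal_eq]; exact Ideal.mem_span_singleton_self _
    exact Ideal.mem_comap.mp this
  -- `#H_0 = e_{L/E}`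
  haveI : IsLocalHom (algebraMap 𝒪[F] (integralClosure 𝒪[F] E)) :=
    Algebra.IsIntegral.isLocalHom 𝒪[F] (integralClosure 𝒪[F] E)
  haveI : Finite (ResidueField (integralClosure 𝒪[F] E)) :=
    IsLocalRing.ResidueField.finite_of_finite (R := 𝒪[F]) (inferInstanceAs (Finite 𝓀[F]))
  have hcard := natCard_ramificationSubgroup_ker_zero_eq_addVal (R := 𝒪[F])
    (AlgEquiv.restrictNormalHom E : (L ≃ₐ[F] L) →* (E ≃ₐ[F] E)) (E.integralClosureInclusion 𝒪[F])
    hι hequiv hinv hπ'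
  exact indexFormula_of_adjoin_eq_top (R := 𝒪[F]) _ (E.integralClosureInclusion 𝒪[F]) hequiv hinv
    hx hy hπ' hloc hcard

omit [FiniteDimensional F L] [IsGalois F L] [Normal F E] in
/-- **Herbrand's theorem for layers of `F̄` over a non-archimedean local field**: the named fact
`herbrand_quotient 𝒪[F] E` (`RamificationFiltration.lean`: `Gal(E/F)^v = Gal(L/F)^v H/H` at every
maximal ideal of `O_L`, all `v`) for `L/F` finite Galois inside `F̄` and `E` a normal subextension of
`L/F`, from the index formula (`indexFormula_intermediateField`) by the tree's
`upperRamificationSubgroup_eq_map_restrictNormalHom_of_indexFormula` (Serre's Lemmas 3–5, Prop. 15 and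
Prop. 14, `HerbrandTheorem.lean`).  This is the hypothesis `hq` of
`SerreWeightExistence.exists_isSerreWeight_of_herbrand_quotient` and
`absUpperInertia_map_absRestrictNormalHom_of_herbrand_quotient`.
Ref: Serre, *Local Fields*, Ch. IV §3, Prop. 14 (p. 74) with §1 Prop. 3; Neukirch, *Algebraic
Number Theory*, Ch. II (10.7). [cite: SerreLocalFields1979, Ch. IV §3 Prop. 14 and §1 Prop. 3]
[cite: NeukirchANT1999, Ch. II (10.7)] -/
theorem herbrand_quotient_of_isNonarchimedeanLocalField : herbrand_quotient 𝒪[F] E := by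
  intro _ _ _ _ _ 𝔓 _ _ v
  exact upperRamificationSubgroup_eq_map_restrictNormalHom_of_indexFormula 𝒪[F] E 𝔓
    (indexFormula_intermediateField F L E 𝔓) v

end LocalField

end Literature.NumberTheory.GaloisRepresentations
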